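import Summits.ResolutionOfSingularities.ResolutionOfSingularities.Theorems.HomologicalConductorNoZenoSplitGaloisGerm

/-!
# Galois splitting base, IV: the stabiliser acts on `Ŝ` and induces every automorphism of `κ(Ŝ)`

W4.4 (crux `NoZenoR`, stmt-ResolutionOfSingularities-19943), slot 5 `stub_L1wCoreF`, brick
**D2″ (Galois refinement of the splitting base)**, ring side, part 4 (parts 1–3:
`…SplitGaloisRoots`, `…SplitGaloisClosure`, `…SplitGaloisGerm`). In the AKLB frame of Mathlib
(`integralClosure D L`, `galRestrict`, `IsGaloisGroup.of_isFractionRing`,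
`Ideal.Quotient.stabilizerHom_surjective`, `Ideal.Quotient.normal`) this file proves, for the
germ `Ŝ = (integralClosure D L)_𝔫` of part 3 (binders (B2)(B3) of res-L0-w44-stub-2's BINDER LINE
2026-08-27T18:13:56Z, in the `ρ : H →* (Ŝ ≃ₐ[D] Ŝ)` form):

* `exists_algEquiv_localization_extending`, `exists_monoidHom_localization`,
  `algEquiv_localization_ext` — a group of `D`-automorphisms of `B` stabilising `𝔫` acts on
  `B_𝔫` (any `B`, any prime `𝔫`);
* `separable_map_of_separable_residue`, `isGalois_of_isSplittingField` — `L/K` is Galois;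
  `splits_map_localization_integralClosure` — `f` splits in `Ŝ`;
* `normal_residueField_localization_integralClosure` — `κ(Ŝ)/κ(D)` is NORMAL (hence Galois);
* `exists_gal_of_quotient_algEquiv` — every `κ(D)`-automorphism of `B/𝔫` is induced by some
  `σ ∈ Gal(L/K)` with `σ(𝔫) = 𝔫`;
* `exists_group_hom_residue_surjective` — THE PACKAGE: a finite group `H` (the stabiliser of
  `𝔫`) with `ρ : H →* (Ŝ ≃ₐ[D] Ŝ)` such that every `κ(D)`-automorphism of `κ(Ŝ)` is
  `residue ∘ ρ h` for some `h ∈ H`.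

Everything is PROVED; no definitions, no named facts. All statements are [folklore]
(Bourbaki, *Alg. Comm.* V §2 nos. 2–3; Serre, *Corps locaux* I §7).

OURS (cell res-hironaka, chain W4.4); AI-written, weaker than expert review; nothing here is a
statement of the manuscript under review.
-/

noncomputable section

set_option linter.dupNamespace false

open Polynomial

namespace Summit.ResolutionOfSingularities.ResolutionOfSingularities.Theorems.NoZeno.SplittingBase

universe u

/-! ## Galois symmetry of the germ: automorphisms of `Ŝ` from `Gal(L/K)`, normal residue field,
and every `κ`-automorphism of the residue field is induced -/

section Symmetry

open scoped Pointwise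

variable {D : Type u} [CommRing D]

/-- **Induced automorphism of a localisation.** A `D`-algebra automorphism `φ` of `B` with
`φ(𝔫) = 𝔫` induces a `D`-algebra automorphism of `B_𝔫` extending it. [folklore] -/
theorem exists_algEquiv_localization_extending {B : Type u} [CommRing B] [Algebra D B]
    (𝔫 : Ideal B) [𝔫.IsPrime] (φ : B ≃ₐ[D] B) (hφ : 𝔫.map (φ : B →+* B) = 𝔫) :
    ∃ ψ : Localization.AtPrime 𝔫 ≃ₐ[D] Localization.AtPrime 𝔫,
      ∀ b : B, ψ (algebraMap B (Localization.AtPrime 𝔫) b) =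
        algebraMap B (Localization.AtPrime 𝔫) (φ b) := by
  -- `φ⁻¹` stabilises `𝔫` as well
  have hφ' : 𝔫.map (φ.symm : B →+* B) = 𝔫 := by
    conv_lhs => rw [← hφ]
    rw [Ideal.map_map]
    have hc : (φ.symm : B →+* B).comp (φ : B →+* B) = RingHom.id B := by
      ext b; simp
    rw [hc, Ideal.map_id]
  -- membership: `φ b ∈ 𝔫 ↔ b ∈ 𝔫`
  have hmem : ∀ b : B, φ b ∈ 𝔫 ↔ b ∈ 𝔫 := by
    intro b
    constructor
    · intro hb
      have h1 := Ideal.mem_map_of_mem (φ.symm : B →+* B) hb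
      rw [hφ'] at h1
      simpa using h1
    · intro hb
      have h1 := Ideal.mem_map_of_mem (φ : B →+* B) hb
      rw [hφ] at h1
      exact h1
  have H : 𝔫.primeCompl.map (φ : B ≃+* B).toMonoidHom = 𝔫.primeCompl := by
    ext x
    constructor
    · rintro ⟨y, hy, rfl⟩
      intro hx
      exact hy ((hmem y).mp hx)
    · intro hx
      refine ⟨φ.symm x, ?_, ?_⟩
      · intro hy
        apply hx
        have := (hmem (φ.symm x)).mpr hy
        simpa using this
      · change (φ : B ≃+* B) (φ.symm x) = x
        simp
  let e : Localization.AtPrime 𝔫 ≃+* Localization.AtPrime 𝔫 :=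
    IsLocalization.ringEquivOfRingEquiv (M := 𝔫.primeCompl) (T := 𝔫.primeCompl)
      (Localization.AtPrime 𝔫) (Localization.AtPrime 𝔫) (φ : B ≃+* B) H
  have he : ∀ b : B, e (algebraMap B (Localization.AtPrime 𝔫) b) =
      algebraMap B (Localization.AtPrime 𝔫) (φ b) := fun b =>
    IsLocalization.ringEquivOfRingEquiv_eq H b
  refine ⟨AlgEquiv.ofRingEquiv (f := e) fun d => ?_, fun b => he b⟩
  rw [IsScalarTower.algebraMap_apply D B (Localization.AtPrime 𝔫), he, AlgEquiv.commutes]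

variable {K L : Type u} [IsDomain D] [IsIntegrallyClosed D] [IsLocalRing D]
  [Field K] [Algebra D K] [IsFractionRing D K] [Field L] [Algebra K L] [Algebra D L]
  [IsScalarTower D K L]

omit [IsDomain D] [IsIntegrallyClosed D] [IsFractionRing D K] in
/-- `f_K` is separable (its roots in `L ⊇` the integral closure are simple). [folklore] -/
theorem separable_map_of_separable_residue {f : D[X]} (hf : f.Monic)
    (hsep : (f.map (IsLocalRing.residue D)).Separable)
    [Polynomial.IsSplittingField K L (f.map (algebraMap D K))] :
    (f.map (algebraMap D K)).Separable := by
  classical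
  have hsplit := splits_map_of_isSplittingField (K := K) (L := L) f
  have hroots := rootSet_subset_integralClosure (L := L) hf
  have hnd : (f.aroots (integralClosure D L)).Nodup :=
    nodup_aroots_subalgebra hf hsplit hsep _ hroots
  have hndL : (f.aroots L).Nodup := by
    rw [← map_aroots_subalgebra hsplit _ hroots]
    exact hnd.map Subtype.val_injective
  have hne : f.map (algebraMap D K) ≠ 0 := (hf.map _).ne_zero
  have hsplit' : ((f.map (algebraMap D K)).map (algebraMap K L)).Splits := by
    rw [Polynomial.map_map, ← IsScalarTower.algebraMap_eq]; exact hsplit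
  rw [← nodup_aroots_iff_of_splits hne hsplit']
  rwa [aroots_def, Polynomial.map_map, ← IsScalarTower.algebraMap_eq]

omit [IsDomain D] [IsIntegrallyClosed D] [IsFractionRing D K] in
/-- `L/K` is Galois. [folklore] -/
theorem isGalois_of_isSplittingField {f : D[X]} (hf : f.Monic)
    (hsep : (f.map (IsLocalRing.residue D)).Separable)
    [Polynomial.IsSplittingField K L (f.map (algebraMap D K))] : IsGalois K L :=
  IsGalois.of_separable_splitting_field (separable_map_of_separable_residue (L := L) hf hsep)

omit [IsDomain D] [IsIntegrallyClosed D] [IsLocalRing D] [IsFractionRing D K] in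
/-- `f` splits in `Ŝ`. [folklore] -/
theorem splits_map_localization_integralClosure {f : D[X]} (hf : f.Monic)
    [Polynomial.IsSplittingField K L (f.map (algebraMap D K))]
    (𝔫 : Ideal (integralClosure D L)) [𝔫.IsMaximal] :
    (f.map (algebraMap D (Localization.AtPrime 𝔫))).Splits := by
  have h := splits_map_subalgebra (splits_map_of_isSplittingField (K := K) (L := L) f)
    (integralClosure D L) (rootSet_subset_integralClosure hf)
  rw [IsScalarTower.algebraMap_eq D (integralClosure D L) (Localization.AtPrime 𝔫),
    ← Polynomial.map_map]
  exact h.map _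

omit [IsDomain D] [IsIntegrallyClosed D] [IsLocalRing D] in
/-- Bookkeeping between Mathlib's pointwise action of `Gal(L/K)` on ideals of the integral
closure (AKLB frame) and `Ideal.map` of the restriction `galRestrict σ`. [folklore] -/
theorem smul_ideal_eq_map_galRestrict [Algebra.IsAlgebraic K L] (σ : L ≃ₐ[K] L)
    (𝔫 : Ideal (integralClosure D L)) :
    letI := IsIntegralClosure.MulSemiringAction D K L (integralClosure D L)
    σ • 𝔫 = 𝔫.map (galRestrict D K L (integralClosure D L) σ : integralClosure D L →+*
        integralClosure D L) :=
  rfl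

/-- **The residue field `κ(Ŝ)` is normal over `κ(D)`** (hence Galois, being separable).
[folklore; Bourbaki, *Alg. Comm.* V §2 no. 2, Prop. 6] -/
theorem normal_residueField_localization_integralClosure {f : D[X]} (hf : f.Monic)
    (hsep : (f.map (IsLocalRing.residue D)).Separable)
    [Polynomial.IsSplittingField K L (f.map (algebraMap D K))]
    (𝔫 : Ideal (integralClosure D L)) [𝔫.IsMaximal]
    [IsLocalHom (algebraMap D (Localization.AtPrime 𝔫))] :
    Normal (IsLocalRing.ResidueField D)
      (IsLocalRing.ResidueField (Localization.AtPrime 𝔫)) := by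
  haveI := Polynomial.IsSplittingField.finiteDimensional L (f.map (algebraMap D K))
  haveI := isGalois_of_isSplittingField (K := K) (L := L) hf hsep
  letI := IsIntegralClosure.MulSemiringAction D K L (integralClosure D L)
  haveI : IsFractionRing (integralClosure D L) L :=
    IsIntegralClosure.isFractionRing_of_finite_extension D K L (integralClosure D L)
  haveI : IsGaloisGroup (L ≃ₐ[K] L) D (integralClosure D L) :=
    IsGaloisGroup.of_isFractionRing (L ≃ₐ[K] L) D (integralClosure D L) K L
  haveI : 𝔫.LiesOver (IsLocalRing.maximalIdeal D) :=
    ⟨(comap_integralClosure_eq_maximalIdeal (L := L) 𝔫).symm⟩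
  letI : Field (D ⧸ IsLocalRing.maximalIdeal D) := Ideal.Quotient.field _
  letI : Field (integralClosure D L ⧸ 𝔫) := Ideal.Quotient.field _
  have hN : Normal (D ⧸ IsLocalRing.maximalIdeal D) (integralClosure D L ⧸ 𝔫) :=
    Ideal.Quotient.normal (L ≃ₐ[K] L) (IsLocalRing.maximalIdeal D) 𝔫
  -- transport along `B/𝔫 ≃ Ŝ/𝔪_Ŝ = κ(Ŝ)`
  set Sh := Localization.AtPrime 𝔫 with hSh
  letI : Field (Sh ⧸ IsLocalRing.maximalIdeal Sh) := Ideal.Quotient.field _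
  let e₀ : (integralClosure D L ⧸ 𝔫) ≃+* Sh ⧸ IsLocalRing.maximalIdeal Sh :=
    IsLocalization.AtPrime.equivQuotMaximalIdeal 𝔫 Sh
  let e : (integralClosure D L ⧸ 𝔫) ≃ₐ[D ⧸ IsLocalRing.maximalIdeal D]
      (Sh ⧸ IsLocalRing.maximalIdeal Sh) :=
    AlgEquiv.ofRingEquiv (f := e₀) fun x => by
      obtain ⟨d, rfl⟩ := Ideal.Quotient.mk_surjective x
      rw [Ideal.Quotient.algebraMap_mk_of_liesOver, Ideal.Quotient.algebraMap_mk_of_liesOver,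
        IsLocalization.AtPrime.equivQuotMaximalIdeal_apply_mk,
        ← IsScalarTower.algebraMap_apply]
  have hN' : Normal (D ⧸ IsLocalRing.maximalIdeal D) (Sh ⧸ IsLocalRing.maximalIdeal Sh) :=
    Normal.of_algEquiv e
  exact hN'

/-- **Every `κ(D)`-automorphism of `B/𝔫` is induced by an element of `Gal(L/K)` stabilising
`𝔫`** (Frobenius-type surjectivity of the decomposition group onto the automorphisms of the
residue extension: Mathlib's `Ideal.Quotient.stabilizerHom_surjective` in the AKLB frame).
[folklore; Bourbaki, *Alg. Comm.* V §2 no. 2, Thm. 2] -/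
theorem exists_gal_of_quotient_algEquiv [Algebra.IsAlgebraic K L] {f : D[X]} (hf : f.Monic)
    (hsep : (f.map (IsLocalRing.residue D)).Separable)
    [Polynomial.IsSplittingField K L (f.map (algebraMap D K))]
    (𝔫 : Ideal (integralClosure D L)) [𝔫.IsMaximal] [𝔫.LiesOver (IsLocalRing.maximalIdeal D)]
    (τ : (integralClosure D L ⧸ 𝔫) ≃ₐ[D ⧸ IsLocalRing.maximalIdeal D]
      (integralClosure D L ⧸ 𝔫)) :
    ∃ σ : L ≃ₐ[K] L,
      𝔫.map (galRestrict D K L (integralClosure D L) σ : integralClosure D L →+*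
        integralClosure D L) = 𝔫 ∧
      ∀ b : integralClosure D L, τ (Ideal.Quotient.mk 𝔫 b) =
        Ideal.Quotient.mk 𝔫 (galRestrict D K L (integralClosure D L) σ b) := by
  haveI := Polynomial.IsSplittingField.finiteDimensional L (f.map (algebraMap D K))
  haveI := isGalois_of_isSplittingField (K := K) (L := L) hf hsep
  letI := IsIntegralClosure.MulSemiringAction D K L (integralClosure D L)
  haveI : IsFractionRing (integralClosure D L) L :=
    IsIntegralClosure.isFractionRing_of_finite_extension D K L (integralClosure D L)
  haveI : IsGaloisGroup (L ≃ₐ[K] L) D (integralClosure D L) :=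
    IsGaloisGroup.of_isFractionRing (L ≃ₐ[K] L) D (integralClosure D L) K L
  obtain ⟨⟨σ, hσ⟩, hστ⟩ :=
    Ideal.Quotient.stabilizerHom_surjective (L ≃ₐ[K] L) (IsLocalRing.maximalIdeal D) 𝔫 τ
  refine ⟨σ, ?_, fun b => ?_⟩
  · have h : σ • 𝔫 = 𝔫 := MulAction.mem_stabilizer_iff.mp hσ
    rw [smul_ideal_eq_map_galRestrict] at h
    exact h
  · rw [← hστ]
    rfl

end Symmetry

/-! ## Packaging the symmetry: a finite group acting on `Ŝ` by `D`-automorphisms and inducing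
every `κ(D)`-automorphism of `κ(Ŝ)` -/

section Package

open scoped Pointwise

variable {D : Type u} [CommRing D]

/-- Two `D`-algebra automorphisms of `B_𝔫` agreeing on `B` are equal. [folklore] -/
theorem algEquiv_localization_ext {B : Type u} [CommRing B] [Algebra D B] (𝔫 : Ideal B)
    [𝔫.IsPrime] {e₁ e₂ : Localization.AtPrime 𝔫 ≃ₐ[D] Localization.AtPrime 𝔫}
    (h : ∀ b : B, e₁ (algebraMap B (Localization.AtPrime 𝔫) b) =
      e₂ (algebraMap B (Localization.AtPrime 𝔫) b)) : e₁ = e₂ := by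
  apply AlgEquiv.ext
  intro x
  have key := IsLocalization.ringHom_ext 𝔫.primeCompl
    (j := (e₁ : Localization.AtPrime 𝔫 →+* Localization.AtPrime 𝔫))
    (k := (e₂ : Localization.AtPrime 𝔫 →+* Localization.AtPrime 𝔫))
    (RingHom.ext fun b => by simpa using h b)
  exact RingHom.congr_fun key x

/-- **A group acting on `B` by `D`-automorphisms stabilising `𝔫` acts on `B_𝔫`** (by a group
homomorphism to the `D`-automorphisms of `B_𝔫`, compatibly with `B → B_𝔫`). [folklore] -/
theorem exists_monoidHom_localization {B : Type u} [CommRing B] [Algebra D B] (𝔫 : Ideal B)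
    [𝔫.IsPrime] {H : Type u} [Group H] (χ : H →* (B ≃ₐ[D] B))
    (hχ : ∀ h : H, 𝔫.map (χ h : B →+* B) = 𝔫) :
    ∃ ρ : H →* (Localization.AtPrime 𝔫 ≃ₐ[D] Localization.AtPrime 𝔫),
      ∀ (h : H) (b : B), ρ h (algebraMap B (Localization.AtPrime 𝔫) b) =
        algebraMap B (Localization.AtPrime 𝔫) (χ h b) := by
  choose ψ hψ using fun h : H => exists_algEquiv_localization_extending 𝔫 (χ h) (hχ h)
  refine ⟨{ toFun := ψ, map_one' := ?_, map_mul' := ?_ }, fun h b => hψ h b⟩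
  · apply algEquiv_localization_ext 𝔫
    intro b
    rw [hψ, map_one, AlgEquiv.one_apply, AlgEquiv.one_apply]
  · intro g h
    apply algEquiv_localization_ext 𝔫
    intro b
    rw [hψ, map_mul, AlgEquiv.mul_apply, AlgEquiv.mul_apply, hψ, hψ]

variable {K L : Type u} [IsDomain D] [IsIntegrallyClosed D] [IsLocalRing D]
  [Field K] [Algebra D K] [IsFractionRing D K] [Field L] [Algebra K L] [Algebra D L]
  [IsScalarTower D K L]

omit [IsDomain D] [IsIntegrallyClosed D] [IsLocalRing D] [IsFractionRing D K] [IsScalarTower D K L] in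
/-- The residue map of `Ŝ` on `B`: `residue (b/1) = e(b mod 𝔫)` for the canonical
`B/𝔫 ≃ Ŝ/𝔪_Ŝ`. Bookkeeping. [folklore] -/
theorem residue_algebraMap_eq (𝔫 : Ideal (integralClosure D L)) [𝔫.IsMaximal]
    (b : integralClosure D L) :
    IsLocalRing.residue (Localization.AtPrime 𝔫) (algebraMap _ (Localization.AtPrime 𝔫) b) =
      IsLocalization.AtPrime.equivQuotMaximalIdeal 𝔫 (Localization.AtPrime 𝔫)
        (Ideal.Quotient.mk 𝔫 b) := by
  rw [IsLocalization.AtPrime.equivQuotMaximalIdeal_apply_mk]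
  rfl

/-- **D2″ symmetry package.** For `D` an integrally closed local domain with fraction field `K`,
`f ∈ D[X]` monic with separable reduction, `L` a splitting field of `f` over `K` and `𝔫` a maximal
ideal of the integral closure `B = D[α₁, …, αₙ]` of `D` in `L`: there is a FINITE group `H` (the
stabiliser of `𝔫` in `Gal(L/K)`) acting on `Ŝ = B_𝔫` through `D`-algebra automorphisms such that
EVERY `κ(D)`-automorphism of the residue field `κ(Ŝ)` is induced by an element of `H`.
[folklore; Bourbaki, *Alg. Comm.* V §2 no. 2–3] -/
theorem exists_group_hom_residue_surjective {f : D[X]} (hf : f.Monic)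
    (hsep : (f.map (IsLocalRing.residue D)).Separable)
    [Polynomial.IsSplittingField K L (f.map (algebraMap D K))]
    (𝔫 : Ideal (integralClosure D L)) [𝔫.IsMaximal]
    [IsLocalHom (algebraMap D (Localization.AtPrime 𝔫))] :
    ∃ (H : Type u) (_ : Group H) (_ : Finite H)
      (ρ : H →* (Localization.AtPrime 𝔫 ≃ₐ[D] Localization.AtPrime 𝔫)),
      ∀ σ : IsLocalRing.ResidueField (Localization.AtPrime 𝔫) ≃ₐ[IsLocalRing.ResidueField D]
          IsLocalRing.ResidueField (Localization.AtPrime 𝔫),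
        ∃ h : H, ∀ x : Localization.AtPrime 𝔫,
          IsLocalRing.residue _ (ρ h x) = σ (IsLocalRing.residue _ x) := by
  haveI := Polynomial.IsSplittingField.finiteDimensional L (f.map (algebraMap D K))
  haveI := isGalois_of_isSplittingField (K := K) (L := L) hf hsep
  letI := IsIntegralClosure.MulSemiringAction D K L (integralClosure D L)
  haveI : 𝔫.LiesOver (IsLocalRing.maximalIdeal D) :=
    ⟨(comap_integralClosure_eq_maximalIdeal (L := L) 𝔫).symm⟩
  -- the stabiliser and its action on `Ŝ`
  let H : Subgroup (L ≃ₐ[K] L) := MulAction.stabilizer (L ≃ₐ[K] L) 𝔫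
  let χ : H →* (integralClosure D L ≃ₐ[D] integralClosure D L) :=
    (galRestrict D K L (integralClosure D L)).toMonoidHom.comp H.subtype
  have hχ : ∀ h : H, 𝔫.map (χ h : integralClosure D L →+* integralClosure D L) = 𝔫 := by
    intro h
    have h1 : (h : L ≃ₐ[K] L) • 𝔫 = 𝔫 := MulAction.mem_stabilizer_iff.mp h.2
    rw [smul_ideal_eq_map_galRestrict] at h1
    exact h1
  obtain ⟨ρ, hρ⟩ := exists_monoidHom_localization 𝔫 χ hχ
  refine ⟨H, inferInstance, inferInstance, ρ, fun σ => ?_⟩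
  -- transport `σ` to `B/𝔫` over `D/𝔪`
  letI : Field (D ⧸ IsLocalRing.maximalIdeal D) := Ideal.Quotient.field _
  letI : Field (integralClosure D L ⧸ 𝔫) := Ideal.Quotient.field _
  letI : Field (Localization.AtPrime 𝔫 ⧸
      IsLocalRing.maximalIdeal (Localization.AtPrime 𝔫)) := Ideal.Quotient.field _
  let e₀ : (integralClosure D L ⧸ 𝔫) ≃+*
      Localization.AtPrime 𝔫 ⧸ IsLocalRing.maximalIdeal (Localization.AtPrime 𝔫) :=
    IsLocalization.AtPrime.equivQuotMaximalIdeal 𝔫 (Localization.AtPrime 𝔫)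
  let e : (integralClosure D L ⧸ 𝔫) ≃ₐ[D ⧸ IsLocalRing.maximalIdeal D]
      (Localization.AtPrime 𝔫 ⧸ IsLocalRing.maximalIdeal (Localization.AtPrime 𝔫)) :=
    AlgEquiv.ofRingEquiv (f := e₀) fun x => by
      obtain ⟨d, rfl⟩ := Ideal.Quotient.mk_surjective x
      rw [Ideal.Quotient.algebraMap_mk_of_liesOver, Ideal.Quotient.algebraMap_mk_of_liesOver,
        IsLocalization.AtPrime.equivQuotMaximalIdeal_apply_mk,
        ← IsScalarTower.algebraMap_apply]
  let σ' : (Localization.AtPrime 𝔫 ⧸ IsLocalRing.maximalIdeal (Localization.AtPrime 𝔫))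
      ≃ₐ[D ⧸ IsLocalRing.maximalIdeal D]
      (Localization.AtPrime 𝔫 ⧸ IsLocalRing.maximalIdeal (Localization.AtPrime 𝔫)) := σ
  let τ : (integralClosure D L ⧸ 𝔫) ≃ₐ[D ⧸ IsLocalRing.maximalIdeal D]
      (integralClosure D L ⧸ 𝔫) := (e.trans σ').trans e.symm
  have hτ : ∀ y : integralClosure D L ⧸ 𝔫, e (τ y) = σ (e y) := by
    intro y
    change e (e.symm (σ' (e y))) = σ' (e y)
    rw [AlgEquiv.apply_symm_apply]
  obtain ⟨g, hg𝔫, hgτ⟩ := exists_gal_of_quotient_algEquiv (K := K) (L := L) hf hsep 𝔫 τ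
  have hgH : g ∈ H := MulAction.mem_stabilizer_iff.mpr (by
    rw [smul_ideal_eq_map_galRestrict]; exact hg𝔫)
  refine ⟨⟨g, hgH⟩, ?_⟩
  -- compare the two ring maps `Ŝ → κ(Ŝ)` on `B`
  have hρg : ∀ b : integralClosure D L, ρ ⟨g, hgH⟩ (algebraMap _ (Localization.AtPrime 𝔫) b) =
      algebraMap _ (Localization.AtPrime 𝔫) (galRestrict D K L (integralClosure D L) g b) :=
    fun b => hρ _ b
  have key : (IsLocalRing.residue (Localization.AtPrime 𝔫)).comp
      ((ρ ⟨g, hgH⟩ : Localization.AtPrime 𝔫 ≃ₐ[D] Localization.AtPrime 𝔫) :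
        Localization.AtPrime 𝔫 →+* Localization.AtPrime 𝔫) =
      (σ : IsLocalRing.ResidueField (Localization.AtPrime 𝔫) →+*
        IsLocalRing.ResidueField (Localization.AtPrime 𝔫)).comp
        (IsLocalRing.residue (Localization.AtPrime 𝔫)) := by
    refine IsLocalization.ringHom_ext 𝔫.primeCompl (RingHom.ext fun b => ?_)
    change IsLocalRing.residue _ (ρ _ (algebraMap _ (Localization.AtPrime 𝔫) b)) =
      σ (IsLocalRing.residue _ (algebraMap _ (Localization.AtPrime 𝔫) b))
    rw [hρg, residue_algebraMap_eq, residue_algebraMap_eq]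
    have h2 := hτ (Ideal.Quotient.mk 𝔫 b)
    rw [hgτ b] at h2
    exact h2
  intro x
  exact RingHom.congr_fun key x

end Package

end Summit.ResolutionOfSingularities.ResolutionOfSingularities.Theorems.NoZeno.SplittingBase

end
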